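import Literature.AlgebraicGeometry.ModuliOfAbelianVarieties.Lan2013.Sec11PreliminariesAlgebra
import Literature.RingTheory.CentralSimple.ReducedNormTrace
import HarnessLib

/-!
# [Lan2013, §1.1.1] the (reduced) trace `Tr_{A/K}` EXISTS for `A` central simple: `IsReducedTrace K A Trd_{A/K}`

Topic `Literature/AlgebraicGeometry/ModuliOfAbelianVarieties/Lan2013`, namespace
`Literature.AlgebraicGeometry.ModuliOfAbelianVarieties.Lan2013.Sec11PreliminariesAlgebra` (cell `hodgecm-mathlib`, typer
seat B-typ04 (g36)).  Proof-lane companion, BY IMPORT, of the statement carpet ★ `Sec11PreliminariesAlgebra`, resolving its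
recorded `-- TODO: bridge lemma IsReducedTrace K A Tr ↔ Tr = reducedTrace K A` in the direction the carpet's facts need:
the §1.1.1 facts (★ `Lan2013_1117`, `Lan2013_1119`, `Lan2013_11116`, `Lan2013_11119`, `Lan2013_11121`, …) take the trace
functional as a PARAMETER `Tr : A →ₗ[K] K` under the hypothesis `IsReducedTrace K A Tr` («after some splitting
`L ⊗_K A ≃ₐ[L] Πᵢ M_{nᵢ}(L)` over a field `L ⊇ K`, `Tr` is the sum of the matrix traces»); this file PROVES that hypothesis
is satisfiable — by Bourbaki's reduced trace ★ `Literature.RingTheory.CentralSimple.reducedTrace K A` — whenever `A` is a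
finite-dimensional CENTRAL SIMPLE `K`-algebra (`exists_isReducedTrace_of_isCentral_isSimple`, `exists_isReducedTrace`),
so those rows are not vacuous in the central simple case; and CONVERSELY (`IsReducedTrace.apply_eq_reducedTrace`,
`isReducedTrace_iff_forall_apply_eq_reducedTrace`) any `Tr` with `IsReducedTrace K A Tr` equals `Trd_{A/K}` — the
carpet's TODO bridge both ways for central simple `A`.  THEOREMS ONLY (no `def`, no new named fact — D-0026, net debt 0).

HONEST SCOPE: the general separable case («`A` Artinian semisimple with separable centre», ★ `IsSeparableAlgebra`:
`Tr_{A/K} = Σⱼ Tr_{Zⱼ/K} ∘ Trd_{Aⱼ/Zⱼ}`) is NOT treated here; it needs the `K`-rationality of the split trace sum for a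
non-central algebra ([102] = Reiner, *Maximal Orders*, §9, Thm. 9.26), which the tree does not have.

Sources: [Lan2013PELCompactifications, §1.1.1 (2010 rev. p. 3)] «By definition, `A` is Artinian and semisimple […] we
shall suppress the modifier *reduced* from traces and norms»; the splitting formula is [BourbakiAlgebreVIII2012, VIII
§17 n°3, Cor. 1 to Prop. 4, formula (32) (p. A VIII.335)] «`Trd_{A/K}(a) = Tr(θ(a))`» for any `K`-algebra map
`θ : A → M_n(L)`, `n` the reduced degree — in the tree as ★ `CentralSimple.algebraMap_reducedTrace_eq_trace`, with the
splitting representation ★ `CentralSimple.exists_algHom_matrix_reducedDegree` and the induced `L`-isomorphism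
★ `CentralSimple.bijective_lift_of_algHom_matrix` («`θ'` est un isomorphisme»).

## The proof

Take Bourbaki's splitting representation `θ : A →ₐ[K] M_n(E)` (`n = reducedDegree K A`, `E` a field over `K` in the
universe of `K`), move it to the universe `max v w` demanded by `IsReducedTrace` (`L := ULift E`, `ULift.algEquiv`,
`AlgEquiv.mapMatrix`), extend it to the `L`-algebra isomorphism `e : L ⊗_K A ≃ₐ[L] M_n(L)` (bijective lift), index the
one-block product by `Fin 1` (`AlgEquiv.funUnique`), and read formula (32): `algebraMap K L (Trd a) = tr (θ' a) = tr (e (1 ⊗ a))`.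
Conversely, for ANY splitting `e : L ⊗_K A ≃ₐ[L] Πᵢ M_{nᵢ}(L)`: `L ⊗_K A` is simple (★ `isSimpleRing_tensorProduct`), so the
projection onto a non-empty block `i₀` is injective (Mathlib `RingHom.injective` for simple rings) and the unit `δᵢ` of
any other block vanishes, i.e. `nᵢ = 0` for `i ≠ i₀`; then `d² = dim_L (L ⊗ A) = Σ nᵢ² = n_{i₀}²`, and formula (32) for
`θ := a ↦ e(1 ⊗ a)_{i₀}` identifies `Tr` with `Trd` (`algebraMap K L` is injective).

## Mathlib / Literature search

`lean search --decl 'IsReducedTrace|reducedTrace'` → ★ `Sec11PreliminariesAlgebra.IsReducedTrace` (the predicate, no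
existence lemma: `rg "IsReducedTrace" lean/Literature` lists only hypotheses and the two `IsReducedTrace.*` consequences in
★ `Sec11PreliminariesAlgebraHolds`), ★ `CentralSimple.ReducedNormTrace` (Bourbaki `Trd`, used).  Mathlib has no reduced
trace.  Presearch: `lit search --hybrid "reduced trace central simple algebra splitting field sum of matrix traces"` →
McConnell–Robson 2001 p. 430, Le Bruyn 2008 p. 125 (Cayley–Hamilton algebras), Amitsur–Saltman 1982 — classical context;
the tree's source for the formula is Bourbaki A VIII §17 (★ `ReducedNormTrace`); Reiner §9 = Lan's [102] is needed only
for the untreated non-central case.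
-/

open scoped TensorProduct

namespace Literature.AlgebraicGeometry.ModuliOfAbelianVarieties.Lan2013.Sec11PreliminariesAlgebra

universe v w

open Literature.RingTheory.CentralSimple

/-- **The reduced trace of a central simple algebra IS a (reduced) trace in the sense of ★ `IsReducedTrace`**: for `A`
finite-dimensional central simple over `K` there is a `K`-linear functional `Tr` — Bourbaki's `Trd_{A/K}`
(★ `CentralSimple.reducedTrace K A`) — with `IsReducedTrace K A Tr`: after the splitting `L ⊗_K A ≃ₐ[L] M_n(L)` induced
by a splitting representation `θ : A → M_n(L)`, `Trd_{A/K}(a) = Tr(θ(a))` (formula (32)).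
[cite: Lan2013PELCompactifications, §1.1.1 (2010 rev. p. 3)]
[cite: BourbakiAlgebreVIII2012, VIII §17 n°3 Cor. 1 to Prop. 4, formula (32) (p. A VIII.335)] -/
theorem exists_isReducedTrace_of_isCentral_isSimple (K : Type v) [Field K] (A : Type w) [Ring A] [Algebra K A]
    [Algebra.IsCentral K A] [IsSimpleRing A] [FiniteDimensional K A] :
    ∃ Tr : A →ₗ[K] K, (∀ a, Tr a = reducedTrace K A a) ∧ IsReducedTrace K A Tr := by
  classical
  obtain ⟨E, _, _, ⟨θ⟩⟩ := exists_algHom_matrix_reducedDegree K A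
  set n := reducedDegree K A with hn
  -- move the splitting field to the universe `max v w` of `K ⊗ A`
  let L : Type (max v w) := ULift.{w} E
  let u : Matrix (Fin n) (Fin n) E ≃ₐ[K] Matrix (Fin n) (Fin n) L :=
    (ULift.algEquiv (R := K) (A := E)).symm.mapMatrix
  let θ' : A →ₐ[K] Matrix (Fin n) (Fin n) L := (u : _ →ₐ[K] _).comp θ
  -- «`θ'` est un isomorphisme»: the induced `L`-algebra isomorphism `L ⊗_K A ≃ M_n(L)`
  let e : L ⊗[K] A ≃ₐ[L] Matrix (Fin n) (Fin n) L :=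
    AlgEquiv.ofBijective _ (bijective_lift_of_algHom_matrix hn.symm θ')
  have he : ∀ a : A, e ((1 : L) ⊗ₜ[K] a) = θ' a := fun a ↦ by
    change Algebra.TensorProduct.lift (Algebra.ofId L (Matrix (Fin n) (Fin n) L)) θ'
      (fun l a => Algebra.commutes l (θ' a)) ((1 : L) ⊗ₜ[K] a) = θ' a
    rw [Algebra.TensorProduct.lift_tmul, map_one, one_mul]
  let Tr : A →ₗ[K] K :=
    { toFun := reducedTrace K A
      map_add' := reducedTrace_add K
      map_smul' := fun c a ↦ reducedTrace_smul c a }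
  refine ⟨Tr, fun a ↦ rfl, ?_⟩
  refine ⟨L, inferInstance, inferInstance, Fin 1, inferInstance, fun _ ↦ n,
    e.trans (AlgEquiv.funUnique (R := L) (ι := Fin 1) (S := Matrix (Fin n) (Fin n) L)).symm, fun a ↦ ?_⟩
  rw [Fin.sum_univ_one]
  change algebraMap K L (reducedTrace K A a) =
    Matrix.trace ((AlgEquiv.funUnique (R := L) (ι := Fin 1) (S := Matrix (Fin n) (Fin n) L)).symm
      (e ((1 : L) ⊗ₜ[K] a)) 0)
  rw [he, algebraMap_reducedTrace_eq_trace hn.symm θ' a]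
  rfl

/-- **Non-vacuity of the `IsReducedTrace` hypothesis of §1.1.1's facts for central simple `A`**: some `K`-linear
functional is a reduced trace. [cite: Lan2013PELCompactifications, §1.1.1 (2010 rev. p. 3)] -/
theorem exists_isReducedTrace (K : Type v) [Field K] (A : Type w) [Ring A] [Algebra K A]
    [Algebra.IsCentral K A] [IsSimpleRing A] [FiniteDimensional K A] :
    ∃ Tr : A →ₗ[K] K, IsReducedTrace K A Tr := by
  obtain ⟨Tr, -, hTr⟩ := exists_isReducedTrace_of_isCentral_isSimple K A
  exact ⟨Tr, hTr⟩

/-- **Conversely, every (reduced) trace of a central simple algebra IS Bourbaki's `Trd_{A/K}`**: if `Tr` satisfies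
★ `IsReducedTrace K A Tr` (sum of the block traces after SOME splitting `e : L ⊗_K A ≃ₐ[L] Πᵢ M_{nᵢ}(L)`), then
`Tr = Trd_{A/K}`.  Since `L ⊗_K A` is simple (tree ★ `CentralSimple.isSimpleRing_tensorProduct`), exactly one block of
the splitting is non-empty (the projection onto a non-empty block is injective, so the unit of any other block is `0`),
its size is the reduced degree (dimension count), and formula (32) applies to `a ↦ e(1 ⊗ a)_{i₀}`.  Together with
`exists_isReducedTrace_of_isCentral_isSimple` this is the carpet's TODO bridge «`IsReducedTrace K A Tr ↔ Tr = Trd_{A/K}`»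
for central simple `A`. [cite: Lan2013PELCompactifications, §1.1.1 (2010 rev. p. 3)]
[cite: BourbakiAlgebreVIII2012, VIII §17 n°3 Cor. 1 to Prop. 4, formula (32) (p. A VIII.335)] -/
theorem IsReducedTrace.apply_eq_reducedTrace {K : Type v} [Field K] {A : Type w} [Ring A] [Algebra K A]
    [Algebra.IsCentral K A] [IsSimpleRing A] [FiniteDimensional K A] {Tr : A →ₗ[K] K}
    (hTr : IsReducedTrace K A Tr) (a : A) : Tr a = reducedTrace K A a := by
  classical
  obtain ⟨L, _, _, ι, _, n, e, he⟩ := hTr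
  haveI : IsSimpleRing (L ⊗[K] A) := isSimpleRing_tensorProduct (K := K) (D := A) L
  -- dimension count: `d² = Σᵢ nᵢ²`
  have hd : Module.finrank L (L ⊗[K] A) = ∑ i, n i ^ 2 := by
    rw [e.toLinearEquiv.finrank_eq, Module.finrank_pi_fintype]
    refine Finset.sum_congr rfl fun i _ ↦ ?_
    rw [Module.finrank_matrix, Fintype.card_fin, Module.finrank_self, mul_one, pow_two]
  have hd' : Module.finrank L (L ⊗[K] A) = reducedDegree K A ^ 2 := by
    rw [Module.finrank_baseChange, finrank_eq_reducedDegree_sq]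
  -- a non-empty block `i₀`
  obtain ⟨i₀, hi₀⟩ : ∃ i, n i ≠ 0 := by
    by_contra h
    have h0 : ∑ i, n i ^ 2 = 0 := Finset.sum_eq_zero fun i _ ↦ by
      rw [not_exists.mp h i |> not_not.mp, zero_pow two_ne_zero]
    have := reducedDegree_pos K A
    rw [← hd, hd', pow_eq_zero_iff two_ne_zero] at h0
    omega
  -- every other block is empty: the projection onto block `i₀` is injective
  have hothers : ∀ i, i ≠ i₀ → n i = 0 := by
    intro i hi
    by_contra hne
    haveI : Nonempty (Fin (n i₀)) := ⟨⟨0, Nat.pos_of_ne_zero hi₀⟩⟩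
    haveI : Nonempty (Fin (n i)) := ⟨⟨0, Nat.pos_of_ne_zero hne⟩⟩
    let π : (Π j, Matrix (Fin (n j)) (Fin (n j)) L) →+* Matrix (Fin (n i₀)) (Fin (n i₀)) L :=
      Pi.evalRingHom (fun j ↦ Matrix (Fin (n j)) (Fin (n j)) L) i₀
    have hinj : Function.Injective (π.comp e.toRingEquiv.toRingHom) := RingHom.injective _
    let δ : Π j, Matrix (Fin (n j)) (Fin (n j)) L := Pi.single i 1
    have h1 : (π.comp e.toRingEquiv.toRingHom) (e.symm δ) = 0 := by
      change (e (e.symm δ)) i₀ = 0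
      rw [AlgEquiv.apply_symm_apply]
      exact Pi.single_eq_of_ne (Ne.symm hi) 1
    have h2 : e.symm δ = 0 := hinj (by rw [h1, map_zero])
    have h3 : δ = 0 := by
      have := congrArg e h2
      rwa [AlgEquiv.apply_symm_apply, map_zero] at this
    have h4 : (1 : Matrix (Fin (n i)) (Fin (n i)) L) = 0 := by
      have := congrFun h3 i
      change Pi.single (M := fun j ↦ Matrix (Fin (n j)) (Fin (n j)) L) i 1 i = 0 at this
      rwa [Pi.single_eq_same] at this
    exact one_ne_zero h4
  -- hence the block `i₀` has size the reduced degree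
  have hsum : ∑ i, n i ^ 2 = n i₀ ^ 2 :=
    Finset.sum_eq_single i₀ (fun i _ hi ↦ by rw [hothers i hi, zero_pow two_ne_zero]) (fun h ↦ absurd (Finset.mem_univ _) h)
  have hn : reducedDegree K A = n i₀ := by
    have h := hd'.symm.trans (hd.trans hsum)
    exact Nat.pow_left_injective two_ne_zero h
  -- the splitting representation through the block `i₀`, and formula (32)
  let θ : A →ₐ[K] Matrix (Fin (n i₀)) (Fin (n i₀)) L :=
    ((Pi.evalAlgHom L (fun j ↦ Matrix (Fin (n j)) (Fin (n j)) L) i₀).restrictScalars K).comp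
      ((e.restrictScalars K).toAlgHom.comp Algebra.TensorProduct.includeRight)
  have hθ : ∀ b : A, θ b = e ((1 : L) ⊗ₜ[K] b) i₀ := fun b ↦ rfl
  have htr : ∀ i, i ≠ i₀ → ∀ M : Matrix (Fin (n i)) (Fin (n i)) L, M.trace = 0 := by
    intro i hi M
    have hlt : ∀ j : Fin (n i), False := fun j ↦ by
      have hj := j.2
      simp only [hothers i hi] at hj
      exact Nat.not_lt_zero _ hj
    haveI : IsEmpty (Fin (n i)) := ⟨hlt⟩
    exact Fintype.sum_empty _
  have key : algebraMap K L (Tr a) = algebraMap K L (reducedTrace K A a) := by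
    rw [he a, algebraMap_reducedTrace_eq_trace hn θ a, hθ,
      Finset.sum_eq_single i₀ (fun i _ hi ↦ htr i hi _) (fun h ↦ absurd (Finset.mem_univ _) h)]
  exact (algebraMap K L).injective key

/-- **The bridge, assembled** (central simple `A`): `IsReducedTrace K A Tr ↔ ∀ a, Tr a = Trd_{A/K}(a)`.
[cite: Lan2013PELCompactifications, §1.1.1 (2010 rev. p. 3)] -/
theorem isReducedTrace_iff_forall_apply_eq_reducedTrace (K : Type v) [Field K] (A : Type w) [Ring A] [Algebra K A]
    [Algebra.IsCentral K A] [IsSimpleRing A] [FiniteDimensional K A] (Tr : A →ₗ[K] K) :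
    IsReducedTrace K A Tr ↔ ∀ a, Tr a = reducedTrace K A a := by
  refine ⟨fun h a ↦ h.apply_eq_reducedTrace a, fun h ↦ ?_⟩
  obtain ⟨Tr', hTr', h'⟩ := exists_isReducedTrace_of_isCentral_isSimple K A
  have : Tr = Tr' := LinearMap.ext fun a ↦ by rw [h, hTr']
  rwa [this]

end Literature.AlgebraicGeometry.ModuliOfAbelianVarieties.Lan2013.Sec11PreliminariesAlgebra
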